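import Literature.AnabelianGeometry.EtaleTheta.Discharge.Sec3Thm37UnitProfinite
import Literature.AnabelianGeometry.EtaleTheta.RealifiedDivisorMonoidsOfRlfWeak
import HarnessLib

/-!
# [EtTh] Theorem 3.7 (i) «unit-trivial / unit-profinite type» and (iv) for the CONSTRUCTED Def. 3.6 (i)
# data over the WEAK vocabulary (`ofRlfRWeak`, `ofRlfZWeak`)

S. Mochizuki, *The étale theta function …*, Publ. RIMS **45** (2009) [EtTh], §3, Thm. 3.7 (i), p. 305
(PDF p. 79): "if … `Λ = ℤ` (respectively, `Λ = ℝ`), then `C` is of unit-profinite (respectively,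
unit-trivial) type"; Thm. 3.7 (iv), p. 306 (PDF p. 80): "If `D` is slim, then so is `C`"
[cite: MochizukiEtTh2009, Thm 3.7 p.79].

Proof-only sequel (theorems only, no definitions) of abc-iut-w5-d164's `Discharge/Sec3Thm37Units.lean` /
`Sec3Thm37UnitProfinite.lean`, whose closing sections instantiate the vocabulary-generic theorems
(`thm37_i_unitTrivial_of_divΛ_injective`, `thm37_iv_of_divΛ_injective`,
`isOfUnitProfiniteType_of_kerIsoPadicUnits`, `thm37_iv_of_kerIsoPadicUnits`) at abc-iut-L6-t12's
constructors `ofRlfR` / `ofRlfZ` over `treeMonoidVocab` (printed Prop. 3.4 (i), which fails at `Ÿ`, `Z_∞`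
— cell findings F-L2d2-1 / F-L2d2-2).  THIS FILE gives the same instantiations at the WEAK-vocabulary
constructors `ofRlfRWeak` / `ofRlfZWeak` (`RealifiedDivisorMonoidsOfRlfWeak.lean`; hypothesis
`IsPerfFactorialCof`): `ofRlfRWeak_divΛ_injective` (`B₀^ℝ := ℝ·Φ₀^birat → (Φ₀^ℝ)^gp` is the inclusion),
`thm37_i_unitTrivial_ofRlfRWeak`, `thm37_i_unitConjuncts_ofRlfRWeak`, `thm37_iv_ofRlfRWeak` (modulo `hF`
only), their `treeCatVocab` forms modulo `hBmon` only, and `thm37_i_unitProfinite_and_iv_ofRlfZWeak_treeCatVocab`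
(modulo `hBmon` and the Prop. 3.4 (ii) isomorphisms `hP34` BY NAME).  (The Thm 3.7 (ii) non-dilating
unfolding at `treeMonoidVocabWeak` is abc-iut-L2-d2's `Sec3Thm37StandardWeak.lean`.)  Seat abc-iut-L6-t12 (cell abc-iut;
F-L2d2-1 / F-L2d2-2 repair chain, piece (I)).  HONEST FRAMING: refereed pre-IUT material; nothing here
bears on [IUTchIII] Cor. 3.12.
-/

namespace Literature.AnabelianGeometry.EtaleTheta

open CategoryTheory Opposite Literature.AlgebraicGeometry.Frobenioids

universe u₀ v₀ u v w uK

/-- For the CONSTRUCTED weak-vocabulary Def. 3.6 (i) data of monoid type `ℝ` (`B₀^ℝ := ℝ·Φ₀^birat ⊆ (Φ₀^ℝ)^gp`)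
the map `B₀^ℝ(Y) → (Φ₀^ℝ)^gp(Y)` is the inclusion, hence injective. [cite: MochizukiEtTh2009, Def 3.6 p.76] -/
theorem RealifiedDivisorMonoids.ofRlfRWeak_divΛ_injective {D₀ : Type u₀} [Category.{v₀} D₀]
    (dm : DivisorMonoids.{u₀, v₀, w} D₀) (hpf : ∀ Y : D₀ᵒᵖ, IsPerfFactorialCof (dm.Φ₀.obj Y))
    (Y : D₀ᵒᵖ) :
    Function.Injective ((RealifiedDivisorMonoids.ofRlfRWeak dm hpf).divΛ Y) :=
  fun _ _ h => Subtype.ext h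

namespace TemperedFrobenioid

/-! ### Monoid type `ℝ`: `ofRlfRWeak` -/

section OfRlfRWeak

variable {D₀ : Type u₀} [Category.{v₀} D₀] (dm : DivisorMonoids.{u₀, v₀, w} D₀)
  (hpf : ∀ Y : D₀ᵒᵖ, IsPerfFactorialCof (dm.Φ₀.obj Y)) {D : Type u} [Category.{v} D]

section AnyVocab

variable {VD : FrdICatStub.{u, v, w} D}

/-- A tempered Frobenioid over `ofRlfRWeak` data has monoid type `ℝ`. [cite: MochizukiEtTh2009, Def 3.6 p.77] -/
theorem monoidType_ofRlfRWeak
    (C₀ : TemperedFrobenioid (RealifiedDivisorMonoids.ofRlfRWeak dm hpf) D VD) :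
    C₀.monoidType = MonoidType.R := rfl

/-- **Thm 3.7 (i), "unit-trivial type", for every tempered Frobenioid of monoid type `ℝ` over the weak
constructed data `ofRlfRWeak`**, modulo `hF` only. [cite: MochizukiEtTh2009, Thm 3.7 p.79] -/
theorem thm37_i_unitTrivial_ofRlfRWeak
    (C₀ : TemperedFrobenioid (RealifiedDivisorMonoids.ofRlfRWeak dm hpf) D VD)
    (hF : PreFrobenioid.IsFrobenioid C₀.toElem) :
    PreFrobenioid.IsOfType (PreFrobenioid.IsUnitTrivial C₀.toElem) :=
  C₀.thm37_i_unitTrivial_of_divΛ_injective hF fun A =>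
    RealifiedDivisorMonoids.ofRlfRWeak_divΛ_injective dm hpf (C₀.baseOp A)

/-- The two UNIT conjuncts of abc-iut-L2-t3's typed `Thm37_i F` for tempered Frobenioids over `ofRlfRWeak`
data and ANY facade `F` (the `Λ = ℤ` conjunct is vacuous: the monoid type is `ℝ`), modulo `hF`.
[cite: MochizukiEtTh2009, Thm 3.7 p.79] -/
theorem thm37_i_unitConjuncts_ofRlfRWeak
    (C₀ : TemperedFrobenioid (RealifiedDivisorMonoids.ofRlfRWeak dm hpf) D VD)
    (F : FrobenioidFacade.{u, v, w} D)
    (hF : PreFrobenioid.IsFrobenioid C₀.toElem) :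
    (C₀.monoidType = MonoidType.Z → F.IsOfUnitProfiniteType C₀.toElem) ∧
      (C₀.monoidType = MonoidType.R →
        PreFrobenioid.IsOfType (PreFrobenioid.IsUnitTrivial C₀.toElem)) :=
  ⟨fun h => absurd ((C₀.monoidType_ofRlfRWeak dm hpf).symm.trans h) (by decide),
    fun _ => C₀.thm37_i_unitTrivial_ofRlfRWeak dm hpf hF⟩

/-- **Thm 3.7 (iv) for every tempered Frobenioid of monoid type `ℝ` over `ofRlfRWeak` data**, modulo
`hF` only (abc-iut-L2-t3's named `Prop` `Thm37_iv`). [cite: MochizukiEtTh2009, Thm 3.7 p.80] -/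
theorem thm37_iv_ofRlfRWeak
    (C₀ : TemperedFrobenioid (RealifiedDivisorMonoids.ofRlfRWeak dm hpf) D VD)
    (hF : PreFrobenioid.IsFrobenioid C₀.toElem) : C₀.Thm37_iv :=
  C₀.thm37_iv_of_divΛ_injective hF fun A =>
    RealifiedDivisorMonoids.ofRlfRWeak_divΛ_injective dm hpf (C₀.baseOp A)

/-- The category of a tempered Frobenioid that is a Frobenioid over `ofRlfRWeak` data has trivial unit
groups `O^×(A) = {1}`. [cite: MochizukiEtTh2009, Thm 3.7 p.79] -/
theorem unitsSubgroup_eq_bot_ofRlfRWeak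
    (C₀ : TemperedFrobenioid (RealifiedDivisorMonoids.ofRlfRWeak dm hpf) D VD)
    (hF : PreFrobenioid.IsFrobenioid C₀.toElem) (X : C₀.category) :
    PreFrobenioid.unitsSubgroup C₀.toElem X = ⊥ :=
  C₀.unitsSubgroup_eq_bot_of_divΛ_injective hF
    (fun A => RealifiedDivisorMonoids.ofRlfRWeak_divΛ_injective dm hpf (C₀.baseOp A)) X

end AnyVocab

section TreeVocab

variable {IsRational IsStrictlyRational : (Dᵒᵖ ⥤ CommMonCat.{w}) → Prop}

/-- At the canonical [FrdI] vocabulary `treeCatVocab`: **Thm 3.7 (i) "unit-trivial type" for monoid type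
`ℝ` over `ofRlfRWeak` data modulo the single residual datum `hBmon : IsMonoidOn B`** (`hF` being abc-iut-L1's
PROVED [FrdI] Thm 5.2 (ii)). [cite: MochizukiEtTh2009, Thm 3.7 p.79] -/
theorem thm37_i_unitTrivial_ofRlfRWeak_treeCatVocab
    (C₀ : TemperedFrobenioid (RealifiedDivisorMonoids.ofRlfRWeak dm hpf) D
      (treeCatVocab D IsRational IsStrictlyRational)) (hBmon : IsMonoidOn C₀.ratFnFunctor) :
    PreFrobenioid.IsOfType (PreFrobenioid.IsUnitTrivial C₀.toElem) :=
  C₀.thm37_i_unitTrivial_ofRlfRWeak dm hpf (C₀.isFrobenioid_treeCatVocab_of_isMonoidOn hBmon)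

/-- At `treeCatVocab`: **Thm 3.7 (iv) for monoid type `ℝ` over `ofRlfRWeak` data modulo `hBmon` only.**
[cite: MochizukiEtTh2009, Thm 3.7 p.80] -/
theorem thm37_iv_ofRlfRWeak_treeCatVocab
    (C₀ : TemperedFrobenioid (RealifiedDivisorMonoids.ofRlfRWeak dm hpf) D
      (treeCatVocab D IsRational IsStrictlyRational)) (hBmon : IsMonoidOn C₀.ratFnFunctor) : C₀.Thm37_iv :=
  C₀.thm37_iv_ofRlfRWeak dm hpf (C₀.isFrobenioid_treeCatVocab_of_isMonoidOn hBmon)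

end TreeVocab

end OfRlfRWeak

/-! ### Monoid type `ℤ`: `ofRlfZWeak` (unit-profinite type from Prop. 3.4 (ii) BY NAME) -/

section OfRlfZWeak

variable {D₀ : Type u₀} [Category.{v₀} D₀] (dm : DivisorMonoids.{u₀, v₀, w} D₀)
  (hpf : ∀ Y : D₀ᵒᵖ, IsPerfFactorialCof (dm.Φ₀.obj Y)) {D : Type u} [Category.{v} D] {p : ℕ} [Fact p.Prime]

section AnyVocab

variable {VD : FrdICatStub.{u, v, w} D}

/-- A tempered Frobenioid over `ofRlfZWeak` data has monoid type `ℤ`. [cite: MochizukiEtTh2009, Def 3.6 p.77] -/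
theorem monoidType_ofRlfZWeak
    (C₁ : TemperedFrobenioid (RealifiedDivisorMonoids.ofRlfZWeak dm hpf) D VD) :
    C₁.monoidType = MonoidType.Z := rfl

/-- **Thm 3.7 (i) "unit-profinite type" and (iv) for the weak `Λ = ℤ` data `ofRlfZWeak`** (`B₀^ℤ := B₀`),
modulo `hF` and the Prop. 3.4 (ii) isomorphisms `Ker(B₀(Y_A)^× → (Φ₀^ℝ)^gp) ≅ O_L^×` (`hP34`) BY NAME.
[cite: MochizukiEtTh2009, Thm 3.7 p.80] -/
theorem thm37_i_unitProfinite_and_iv_ofRlfZWeak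
    (C₁ : TemperedFrobenioid (RealifiedDivisorMonoids.ofRlfZWeak dm hpf) D VD)
    (hF : PreFrobenioid.IsFrobenioid C₁.toElem)
    (hP34 : ∀ A : Dᵒᵖ, ∃ L : PadicFrd.PadicFld.{uK} p, L.IsPadicLocal ∧
      Nonempty ((((RealifiedDivisorMonoids.ofRlfZWeak dm hpf).divΛ (C₁.baseOp A)).comp
        (Units.coeHom ((RealifiedDivisorMonoids.ofRlfZWeak dm hpf).BΛ.obj (C₁.baseOp A)))).ker ≃*
        PadicFrd.unitSubgroup L.K)) :
    PreFrobenioid.IsOfUnitProfiniteType C₁.toElem ∧ C₁.Thm37_iv :=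
  ⟨C₁.isOfUnitProfiniteType_of_kerIsoPadicUnits hF hP34, C₁.thm37_iv_of_kerIsoPadicUnits hF hP34⟩

end AnyVocab

section TreeVocab

variable {IsRational IsStrictlyRational : (Dᵒᵖ ⥤ CommMonCat.{w}) → Prop}

/-- For the weak `Λ = ℤ` data `ofRlfZWeak` at the canonical vocabulary `treeCatVocab`: **Thm 3.7 (i)
"unit-profinite type" and (iv)** modulo abc-iut-L1-t1's residual datum `hBmon : IsMonoidOn B` and the
Prop. 3.4 (ii) isomorphisms `hP34` only. [cite: MochizukiEtTh2009, Thm 3.7 p.80] -/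
theorem thm37_i_unitProfinite_and_iv_ofRlfZWeak_treeCatVocab
    (C₁ : TemperedFrobenioid (RealifiedDivisorMonoids.ofRlfZWeak dm hpf) D
      (treeCatVocab D IsRational IsStrictlyRational)) (hBmon : IsMonoidOn C₁.ratFnFunctor)
    (hP34 : ∀ A : Dᵒᵖ, ∃ L : PadicFrd.PadicFld.{uK} p, L.IsPadicLocal ∧
      Nonempty ((((RealifiedDivisorMonoids.ofRlfZWeak dm hpf).divΛ (C₁.baseOp A)).comp
        (Units.coeHom ((RealifiedDivisorMonoids.ofRlfZWeak dm hpf).BΛ.obj (C₁.baseOp A)))).ker ≃*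
        PadicFrd.unitSubgroup L.K)) :
    PreFrobenioid.IsOfUnitProfiniteType C₁.toElem ∧ C₁.Thm37_iv :=
  C₁.thm37_i_unitProfinite_and_iv_ofRlfZWeak dm hpf (C₁.isFrobenioid_treeCatVocab_of_isMonoidOn hBmon) hP34

end TreeVocab

end OfRlfZWeak

end TemperedFrobenioid

end Literature.AnabelianGeometry.EtaleTheta
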